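import Mathlib
import HarnessLib
import Summits.NavierStokesRegularity.NavierStokesRegularity.Theorems.EfficiencyFloorEnstrophyBudget
import Summits.NavierStokesRegularity.NavierStokesRegularity.Theorems.EfficiencyFloorProductionEfficiencyDecayLuDoeringRung
import Summits.NavierStokesRegularity.NavierStokesRegularity.Theses.EfficiencyFloor

/-!
# Route `EfficiencyFloor`, support `SharpLuDoeringBudget` (stmt-NavierStokesRegularity-25481) — REDUCED to a positive-stretching witness

`SharpLuDoeringBudget` asks for the SHARP one-sided Lu–Doering constant `c⋆` (positive, admissible, minimal) and the enstrophy
budget re-run with it.  This file proves the item CONDITIONALLY on the one ingredient the tree does not hold: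

* a POSITIVE-STRETCHING WITNESS — some smooth divergence-free field with `D⁰, D¹, D² ∈ L²` has strictly positive vortex-stretching
  integral `∫⟪ω, (∇v) ω⟫ > 0` (an explicit-field COMPUTATION; without it the admissible set could contain `0` and the item would be
  false as stated);

and everything else unconditionally: the admissible set `Adm = {c' | ∀ admissible-class w, S(w) ≤ c' Z(w)^{3/4} Pal(w)^{3/4}}` is
non-empty (`K³+1 ∈ Adm`, `EnstrophyBudget.abs_stretchI_le_rpow`), bounded below by a positive number given the witness, closed under
the infimum (so `c⋆ = sInf Adm` is admissible and minimal), and the budget conjunct is `EnstrophyBudget.main`'s bookkeeping with the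
one-sided envelope and `LuDoeringRung.young_envelope` (`2c Z^{3/4}P^{3/4} − 2νP ≤ (27c⁴/(128ν³)) Z³`).

Main theorem: `sharpLuDoeringBudget_of_witness : (∃ admissible w, 0 < S w) → SharpLuDoeringBudget` (no definitions introduced).

HONEST FRAMING: bookkeeping about a sharp constant in an enstrophy inequality along HYPOTHETICAL maximal solutions; the item stays
OPEN until the witness computation lands; nothing here bears on Navier–Stokes regularity.
-/

noncomputable section

set_option linter.dupNamespace false

namespace Summit.NavierStokesRegularity.NavierStokesRegularity.Theorems.EfficiencyFloorSharpLuDoering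

open Set Filter MeasureTheory Topology InnerProductSpace
open scoped RealInnerProductSpace ENNReal NNReal ContDiff
open Literature.Analysis.FluidPDE
open Literature.Claims.NS.Magsanop2026 (E3)
open Literature.Claims.NS.LucardoOlivaes2026 (ensq stretchI)
open Summit.NavierStokesRegularity.NavierStokesRegularity.Theorems.EnstrophyBudget
  (isLocalSolution sobolev_slice abs_stretchI_le_rpow)
open Summit.NavierStokesRegularity.NavierStokesRegularity.Theorems.LucardoOlivaes2026 (hasDerivAt_half_ensq)
open Summit.NavierStokesRegularity.NavierStokesRegularity.Theorems.ProductionEfficiencyDecay.LuDoeringRung (young_envelope)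

/-! No definitions are introduced (pure-proof lane): the admissible class, `S`, `Z`, `Pal` are spelled out as in the item. -/

/-- The admissible class feeds `abs_stretchI_le_rpow`: `|S(w)| ≤ (K³+1) Z^{3/4} Pal^{3/4}`.
[cite: RobinsonRodrigoSadowski2016, (6.7)] -/
theorem abs_S_le {w : E3 → E3}
    (hw : (ContDiff ℝ (⊤ : ℕ∞) w ∧ VectorCalculus.IsDivFree w ∧ (∫⁻ x, ‖iteratedFDeriv ℝ 0 w x‖ₑ ^ 2 < ⊤) ∧
      (∫⁻ x, ‖iteratedFDeriv ℝ 1 w x‖ₑ ^ 2 < ⊤) ∧ (∫⁻ x, ‖iteratedFDeriv ℝ 2 w x‖ₑ ^ 2 < ⊤))) :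
    |(∫ x, ⟪curl w x, fderiv ℝ w x (curl w x)⟫_ℝ)| ≤ ((SNormLESNormFDerivOfEqConst E3 (volume : Measure E3) 2 : ℝ) ^ 3 + 1) *
      (∫ x, ‖curl w x‖ ^ 2) ^ (3 / 4 : ℝ) * (∫ x, frobeniusNormSq (fderiv ℝ (curl w) x)) ^ (3 / 4 : ℝ) := by
  obtain ⟨hsm, hdiv, h0, h1, h2⟩ := hw
  have h0' : ∫⁻ x, ‖w x‖ₑ ^ 2 < ⊤ := by
    refine lt_of_le_of_lt (le_of_eq (lintegral_congr fun x => ?_)) h0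
    rw [← ofReal_norm, ← ofReal_norm, norm_iteratedFDeriv_zero]
  exact abs_stretchI_le_rpow (hsm.of_le (by norm_cast)) hdiv h0' h1 h2

/-- Non-negativity of `Z^{3/4} Pal^{3/4}`. [folklore] -/
theorem prod_nonneg (w : E3 → E3) : 0 ≤ (∫ x, ‖curl w x‖ ^ 2) ^ (3 / 4 : ℝ) * (∫ x, frobeniusNormSq (fderiv ℝ (curl w) x)) ^ (3 / 4 : ℝ) :=
  mul_nonneg (Real.rpow_nonneg (integral_nonneg fun _ => by positivity) _)
    (Real.rpow_nonneg (integral_nonneg fun _ => frobeniusNormSq_nonneg _) _)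

/-- **The sharp constant**, given a positive-stretching witness: the infimum of the admissible constants is positive, admissible
and minimal. [cite: LuDoering2008, eq. (6)] -/
theorem sharp_constant
    (hW : ∃ w : E3 → E3, (ContDiff ℝ (⊤ : ℕ∞) w ∧ VectorCalculus.IsDivFree w ∧ (∫⁻ x, ‖iteratedFDeriv ℝ 0 w x‖ₑ ^ 2 < ⊤) ∧
      (∫⁻ x, ‖iteratedFDeriv ℝ 1 w x‖ₑ ^ 2 < ⊤) ∧ (∫⁻ x, ‖iteratedFDeriv ℝ 2 w x‖ₑ ^ 2 < ⊤)) ∧ 0 < (∫ x, ⟪curl w x, fderiv ℝ w x (curl w x)⟫_ℝ)) :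
    ∃ c : ℝ, 0 < c ∧
      (∀ w : E3 → E3, (ContDiff ℝ (⊤ : ℕ∞) w ∧ VectorCalculus.IsDivFree w ∧ (∫⁻ x, ‖iteratedFDeriv ℝ 0 w x‖ₑ ^ 2 < ⊤) ∧
      (∫⁻ x, ‖iteratedFDeriv ℝ 1 w x‖ₑ ^ 2 < ⊤) ∧ (∫⁻ x, ‖iteratedFDeriv ℝ 2 w x‖ₑ ^ 2 < ⊤)) →
        (∫ x, ⟪curl w x, fderiv ℝ w x (curl w x)⟫_ℝ) ≤ c * (∫ x, ‖curl w x‖ ^ 2) ^ (3 / 4 : ℝ) * (∫ x, frobeniusNormSq (fderiv ℝ (curl w) x)) ^ (3 / 4 : ℝ)) ∧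
      ∀ c' : ℝ, (∀ w : E3 → E3, (ContDiff ℝ (⊤ : ℕ∞) w ∧ VectorCalculus.IsDivFree w ∧ (∫⁻ x, ‖iteratedFDeriv ℝ 0 w x‖ₑ ^ 2 < ⊤) ∧
      (∫⁻ x, ‖iteratedFDeriv ℝ 1 w x‖ₑ ^ 2 < ⊤) ∧ (∫⁻ x, ‖iteratedFDeriv ℝ 2 w x‖ₑ ^ 2 < ⊤)) →
        (∫ x, ⟪curl w x, fderiv ℝ w x (curl w x)⟫_ℝ) ≤ c' * (∫ x, ‖curl w x‖ ^ 2) ^ (3 / 4 : ℝ) * (∫ x, frobeniusNormSq (fderiv ℝ (curl w) x)) ^ (3 / 4 : ℝ)) → c ≤ c' := by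
  obtain ⟨w₀, hw₀, hS⟩ := hW
  -- the admissible set
  set A : Set ℝ := {c' | ∀ w : E3 → E3, (ContDiff ℝ (⊤ : ℕ∞) w ∧ VectorCalculus.IsDivFree w ∧ (∫⁻ x, ‖iteratedFDeriv ℝ 0 w x‖ₑ ^ 2 < ⊤) ∧
      (∫⁻ x, ‖iteratedFDeriv ℝ 1 w x‖ₑ ^ 2 < ⊤) ∧ (∫⁻ x, ‖iteratedFDeriv ℝ 2 w x‖ₑ ^ 2 < ⊤)) →
        (∫ x, ⟪curl w x, fderiv ℝ w x (curl w x)⟫_ℝ) ≤ c' * (∫ x, ‖curl w x‖ ^ 2) ^ (3 / 4 : ℝ) * (∫ x, frobeniusNormSq (fderiv ℝ (curl w) x)) ^ (3 / 4 : ℝ)} with hA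
  have hKA : ((SNormLESNormFDerivOfEqConst E3 (volume : Measure E3) 2 : ℝ) ^ 3 + 1) ∈ A :=
    fun w hw => (le_abs_self _).trans (abs_S_le hw)
  have hne : A.Nonempty := ⟨_, hKA⟩
  -- the witness ratio is a positive lower bound
  have hp0 := prod_nonneg w₀
  have hK0 := hKA w₀ hw₀
  have hprod : 0 < (∫ x, ‖curl w₀ x‖ ^ 2) ^ (3 / 4 : ℝ) * (∫ x, frobeniusNormSq (fderiv ℝ (curl w₀) x)) ^ (3 / 4 : ℝ) := by
    rcases hp0.lt_or_eq with h | h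
    · exact h
    · exfalso; rw [mul_assoc, ← h, mul_zero] at hK0; linarith
  have hlb : ∀ c' ∈ A, (∫ x, ⟪curl w₀ x, fderiv ℝ w₀ x (curl w₀ x)⟫_ℝ) / ((∫ x, ‖curl w₀ x‖ ^ 2) ^ (3 / 4 : ℝ) * (∫ x, frobeniusNormSq (fderiv ℝ (curl w₀) x)) ^ (3 / 4 : ℝ)) ≤ c' := by
    intro c' hc'
    rw [div_le_iff₀ hprod]
    have := hc' w₀ hw₀
    linarith
  have hbdd : BddBelow A := ⟨_, hlb⟩
  refine ⟨sInf A, lt_of_lt_of_le (div_pos hS hprod) (le_csInf hne hlb), ?_, fun c' hc' => csInf_le hbdd hc'⟩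
  -- admissibility of the infimum
  intro w hw
  rcases (prod_nonneg w).lt_or_eq with hp | hp
  · have h1 : (∫ x, ⟪curl w x, fderiv ℝ w x (curl w x)⟫_ℝ) / ((∫ x, ‖curl w x‖ ^ 2) ^ (3 / 4 : ℝ) * (∫ x, frobeniusNormSq (fderiv ℝ (curl w) x)) ^ (3 / 4 : ℝ)) ≤ sInf A := by
      refine le_csInf hne fun c' hc' => ?_
      rw [div_le_iff₀ hp]
      have := hc' w hw
      linarith
    rw [div_le_iff₀ hp] at h1
    linarith
  · have hK := hKA w hw
    rw [mul_assoc, ← hp, mul_zero] at hK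
    rw [mul_assoc, ← hp, mul_zero]
    exact hK

/-- **`SharpLuDoeringBudget` from a positive-stretching witness** (stmt-NavierStokesRegularity-25481, CONDITIONAL on the one
explicit computation the tree lacks: a smooth divergence-free field with `D⁰, D¹, D² ∈ L²` and `∫⟪ω, (∇w) ω⟫ > 0`).
[cite: LuDoering2008, eq. (6); RobinsonRodrigoSadowski2016, (6.7)] -/
theorem sharpLuDoeringBudget_of_witness
    (hW : ∃ w : E3 → E3, (ContDiff ℝ (⊤ : ℕ∞) w ∧ VectorCalculus.IsDivFree w ∧ (∫⁻ x, ‖iteratedFDeriv ℝ 0 w x‖ₑ ^ 2 < ⊤) ∧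
      (∫⁻ x, ‖iteratedFDeriv ℝ 1 w x‖ₑ ^ 2 < ⊤) ∧ (∫⁻ x, ‖iteratedFDeriv ℝ 2 w x‖ₑ ^ 2 < ⊤)) ∧ 0 < (∫ x, ⟪curl w x, fderiv ℝ w x (curl w x)⟫_ℝ)) :
    Summit.NavierStokesRegularity.NavierStokesRegularity.Theses.EfficiencyFloor.SharpLuDoeringBudget := by
  obtain ⟨c, hc0, hadm, hmin⟩ := sharp_constant hW
  refine ⟨c, ⟨hc0, hadm, hmin⟩, ?_⟩
  intro ν T hν hT u p hmax hLH hdec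
  have hLS := isLocalSolution hν hT hmax.isClassicalNSSolutionOn hLH hdec
  refine ⟨fun t => ∫ x, ‖curl (u t) x‖ ^ 2,
    fun t => 2 * (∫ x, ⟪curl (u t) x, fderiv ℝ (u t) x (curl (u t) x)⟫_ℝ)
      - 2 * ν * (∫ x, frobeniusNormSq (fderiv ℝ (curl (u t)) x)), ?_⟩
  intro t ht
  have htI : t ∈ Ico 0 T := ⟨ht.1.le, ht.2⟩
  have hsm : ContDiff ℝ ∞ (u t) := hmax.isClassicalNSSolutionOn.contDiff_velocity htI
  have hn : ∀ n : ℕ, ∫⁻ x, ‖iteratedFDeriv ℝ n (u t) x‖ₑ ^ 2 < ⊤ := sobolev_slice hLS htI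
  have hdiv : VectorCalculus.IsDivFree (u t) := hmax.isClassicalNSSolutionOn.divFree t htI
  refine ⟨lintegral_enorm_curl_sq_eq_ofReal_integral (hsm.of_le (by norm_cast)) (hn 1),
    integral_nonneg fun _ => by positivity, ⟨hsm, hdiv, hn 0, hn 1, hn 2⟩, rfl, ?_, rfl, ?_⟩
  · -- the enstrophy identity, doubled
    have hD := (hasDerivAt_half_ensq hν hLS ht).const_mul 2
    have hfun : (fun s => 2 * ((1 / 2 : ℝ) * ensq u s)) = fun s => ∫ x, ‖curl (u s) x‖ ^ 2 := by
      funext s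
      simp only [ensq]
      ring
    rw [hfun] at hD
    refine hD.congr_deriv ?_
    simp only [stretchI]
    ring
  · -- the cubic law with the sharp constant
    have hS := hadm (u t) ⟨hsm, hdiv, hn 0, hn 1, hn 2⟩
    have hY := young_envelope (c := c) hν (integral_nonneg fun _ => by positivity :
      (0 : ℝ) ≤ ∫ x, ‖curl (u t) x‖ ^ 2)
      (integral_nonneg fun _ => frobeniusNormSq_nonneg _ :
        (0 : ℝ) ≤ ∫ x, frobeniusNormSq (fderiv ℝ (curl (u t)) x))
    linarith

end Summit.NavierStokesRegularity.NavierStokesRegularity.Theorems.EfficiencyFloorSharpLuDoering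

end
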